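import Mathlib.Topology.Separation.Profinite
import Mathlib.Topology.LocallyConstant.Basic
import Mathlib.Topology.Algebra.Support
import Mathlib.Algebra.BigOperators.Group.Finset.Basic
import Mathlib.Data.Complex.Basic
import HarnessLib

/-!
# Extending compactly supported locally constant functions from a closed subset of a locally compact
# totally disconnected space

Topic `Topology`; namespace `Literature.Topology`. THEOREMS ONLY (no definition, no instance, no named fact,
no `sorry`).

Let `G` be a locally compact, Hausdorff, totally disconnected space (e.g. the points of a linear algebraic
group over a non-archimedean local field, or a finite-adelic group) and `C ⊆ G` a subset (the classical
statement assumes `C` closed; the hypothesis turns out to be unnecessary). Then every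
LOCALLY CONSTANT function `f : C → Y` with COMPACT SUPPORT (values in any additive commutative monoid `Y`,
e.g. `ℂ`) is the restriction of a locally constant compactly supported function `F : G → Y`
(`exists_isLocallyConstant_hasCompactSupport_extend`). This is the elementary fact behind "the test
functions (locally constant, compactly supported) on a closed subgroup `H ≤ G` of a totally disconnected
group are the restrictions of test functions on `G`" (Bernstein–Zelevinsky (1976), §1.1–1.3: the space
`S(X)` of locally constant compactly supported functions on an `ℓ`-space and the exactness of restriction to
a closed subset, Prop. 1.8).

Proof. `f` has finitely many values on its (compact) support; for a non-zero value `c` the fibre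
`A_c = f⁻¹{c}` is compact and open in `C`, say `A_c = C ∩ U_c` with `U_c` open in `G`; a compact subset of an
open set of `G` lies in a COMPACT OPEN subset of it (`exists_isCompact_isOpen_superset_subset`, from the basis
of compact open sets, `exists_isCompact_isOpen_mem_subset`); choosing such `W_c` with `A_c ⊆ W_c ⊆ U_c` and
setting `F = ∑_c c · 1_{W_c}` works: on `C`, `W_c ∩ C ⊆ U_c ∩ C = A_c`, so at a point of `C` at most the
term with `c = f(x)` survives.

## References

* I. N. Bernstein, A. V. Zelevinsky, *Representations of the group GL(n, F) where F is a non-archimedean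
  local field*, Russian Math. Surveys 31:3 (1976), §1 (ℓ-spaces, `S(X)`, Prop. 1.8) [BernsteinZelevinsky1976].
-/

open Set Filter Topology

namespace Literature.Topology

section Basis

variable {G : Type*} [TopologicalSpace G] [LocallyCompactSpace G] [T2Space G] [TotallyDisconnectedSpace G]

/-- **Compact open neighbourhoods form a basis** of a locally compact Hausdorff totally disconnected space:
every open neighbourhood `U` of `x` contains a compact open `V ∋ x` (a clopen neighbourhood inside a compact
neighbourhood, Mathlib `loc_compact_Haus_tot_disc_of_zero_dim`). [cite: BernsteinZelevinsky1976, §1.1] -/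
theorem exists_isCompact_isOpen_mem_subset {x : G} {U : Set G} (hU : IsOpen U) (hx : x ∈ U) :
    ∃ V : Set G, IsCompact V ∧ IsOpen V ∧ x ∈ V ∧ V ⊆ U := by
  obtain ⟨s, hsc, hxs, hsU⟩ := exists_compact_subset hU hx
  obtain ⟨V, hVclopen, hxV, hVs⟩ :=
    (loc_compact_Haus_tot_disc_of_zero_dim (H := G)).mem_nhds_iff.1 (isOpen_interior.mem_nhds hxs)
  exact ⟨V, hsc.of_isClosed_subset hVclopen.1 (hVs.trans interior_subset), hVclopen.2, hxV,
    (hVs.trans interior_subset).trans hsU⟩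

/-- **A compact subset of an open set lies in a compact open subset of it** (finitely many compact open
neighbourhoods of its points). [cite: BernsteinZelevinsky1976, §1.1] -/
theorem exists_isCompact_isOpen_superset_subset {K U : Set G} (hK : IsCompact K) (hU : IsOpen U)
    (hKU : K ⊆ U) : ∃ V : Set G, IsCompact V ∧ IsOpen V ∧ K ⊆ V ∧ V ⊆ U := by
  classical
  choose V hV using fun x : K => exists_isCompact_isOpen_mem_subset hU (hKU x.2)
  obtain ⟨t, ht⟩ := hK.elim_finite_subcover V (fun x => (hV x).2.1)
    (fun x hx => mem_iUnion.2 ⟨⟨x, hx⟩, (hV ⟨x, hx⟩).2.2.1⟩)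
  refine ⟨⋃ x ∈ t, V x, t.isCompact_biUnion fun x _ => (hV x).1,
    isOpen_biUnion fun x _ => (hV x).2.1, ht, iUnion₂_subset fun x _ => (hV x).2.2.2⟩

end Basis

section Extend

variable {G : Type*} [TopologicalSpace G] [LocallyCompactSpace G] [T2Space G] [TotallyDisconnectedSpace G]
variable {Y : Type*} [AddCommMonoid Y]

/-- **Extension of compactly supported locally constant functions from a closed subset.** `G` locally
compact, Hausdorff, totally disconnected; `C ⊆ G` ANY subset (closedness is not needed: the support of `f`
is compact anyway); `f : C → Y` locally constant with compact support. Then there is `F : G → Y`, locally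
constant with compact support, with `F x = f x` for every `x ∈ C` (Bernstein–Zelevinsky (1976), Prop. 1.8:
restriction `S(X) → S(Y)` to a closed `ℓ`-subspace is onto).
[cite: BernsteinZelevinsky1976, Prop. 1.8] -/
theorem exists_isLocallyConstant_hasCompactSupport_extend {C : Set G} {f : C → Y}
    (hf : IsLocallyConstant f) (hfs : HasCompactSupport f) :
    ∃ F : G → Y, IsLocallyConstant F ∧ HasCompactSupport F ∧ ∀ x : C, F x = f x := by
  classical
  -- the finitely many values of `f`
  have hKc : IsCompact (tsupport f) := hfs
  have hrange : (Set.range f).Finite := by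
    haveI : CompactSpace (tsupport f) := isCompact_iff_compactSpace.1 hKc
    have hfin : (Set.range (f ∘ ((↑) : tsupport f → C))).Finite :=
      (hf.comp_continuous continuous_subtype_val).range_finite
    refine ((hfin.union (Set.finite_singleton (0 : Y))).subset ?_)
    rintro _ ⟨x, rfl⟩
    by_cases hx : x ∈ tsupport f
    · exact Or.inl ⟨⟨x, hx⟩, rfl⟩
    · exact Or.inr (image_eq_zero_of_notMem_tsupport hx)
  set S : Finset Y := (hrange.toFinset.filter fun c => c ≠ 0) with hS
  have hmemS : ∀ {c}, c ∈ S ↔ c ∈ Set.range f ∧ c ≠ 0 := by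
    intro c
    rw [hS, Finset.mem_filter, Set.Finite.mem_toFinset]
  -- the fibres `A_c`, compact, and open in `C`: `A_c = C ∩ U_c`
  have hUex : ∀ c : Y, ∃ U : Set G, IsOpen U ∧ ((↑) : C → G) ⁻¹' U = f ⁻¹' {c} := fun c =>
    isOpen_induced_iff.1 (hf.isOpen_fiber c)
  choose U hUo hUf using hUex
  have hAc : ∀ c : Y, c ≠ 0 → IsCompact (((↑) : C → G) '' (f ⁻¹' {c})) := by
    intro c hc
    refine (hKc.of_isClosed_subset (hf.isClosed_fiber c) ?_).image continuous_subtype_val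
    exact fun x hx => subset_tsupport f (by rw [Function.mem_support, show f x = c from hx]; exact hc)
  have hAU : ∀ c : Y, ((↑) : C → G) '' (f ⁻¹' {c}) ⊆ U c := by
    rintro c _ ⟨x, hx, rfl⟩
    have : x ∈ ((↑) : C → G) ⁻¹' U c := by rw [hUf]; exact hx
    exact this
  -- compact open `W_c` with `A_c ⊆ W_c ⊆ U_c`
  have hWex : ∀ c : Y, ∃ W : Set G, (c ≠ 0 → IsCompact W ∧ IsOpen W ∧
      ((↑) : C → G) '' (f ⁻¹' {c}) ⊆ W ∧ W ⊆ U c) := by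
    intro c
    by_cases hc : c = 0
    · exact ⟨∅, fun h => (h hc).elim⟩
    · obtain ⟨W, hW⟩ := exists_isCompact_isOpen_superset_subset (hAc c hc) (hUo c) (hAU c)
      exact ⟨W, fun _ => hW⟩
  choose W hW using hWex
  -- the extension
  let F : G → Y := fun y => ∑ c ∈ S, (W c).indicator (fun _ => c) y
  have hFdef : ∀ y, F y = ∑ c ∈ S, (W c).indicator (fun _ => c) y := fun y => rfl
  -- a point of `C` lies in `W_c`, `c ∈ S`, iff `f` takes the value `c` there
  have hWC : ∀ (x : C) (c : Y), c ∈ S → ((x : G) ∈ W c ↔ f x = c) := by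
    intro x c hc
    have hc0 : c ≠ 0 := (hmemS.1 hc).2
    constructor
    · intro hx
      have h1 : (x : G) ∈ U c := (hW c hc0).2.2.2 hx
      have h2 : x ∈ ((↑) : C → G) ⁻¹' U c := h1
      rw [hUf] at h2
      exact h2
    · intro hx
      exact (hW c hc0).2.2.1 ⟨x, hx, rfl⟩
  refine ⟨F, ?_, ?_, fun x => ?_⟩
  · -- locally constant: every indicator is eventually constant near every point
    refine (IsLocallyConstant.iff_eventually_eq F).2 fun y => ?_
    have hev : ∀ c ∈ S, ∀ᶠ z in 𝓝 y, (W c).indicator (fun _ => c) z = (W c).indicator (fun _ => c) y := by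
      intro c hc
      have hc0 : c ≠ 0 := (hmemS.1 hc).2
      by_cases hy : y ∈ W c
      · filter_upwards [(hW c hc0).2.1.mem_nhds hy] with z hz
        rw [Set.indicator_of_mem hz, Set.indicator_of_mem hy]
      · have hcl : IsClosed (W c) := (hW c hc0).1.isClosed
        filter_upwards [hcl.isOpen_compl.mem_nhds hy] with z hz
        rw [Set.indicator_of_notMem hz, Set.indicator_of_notMem hy]
    filter_upwards [(Filter.eventually_all_finset S).2 hev] with z hz
    rw [hFdef, hFdef]
    exact Finset.sum_congr rfl fun c hc => hz c hc
  · -- compact support: `F = 0` off the compact set `⋃_{c ∈ S} W_c`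
    refine HasCompactSupport.intro (S.isCompact_biUnion fun c hc => (hW c (hmemS.1 hc).2).1) fun y hy => ?_
    rw [hFdef]
    refine Finset.sum_eq_zero fun c hc => ?_
    have : y ∉ W c := fun h => hy (mem_biUnion hc h)
    rw [Set.indicator_of_notMem this]
  · -- agreement on `C`
    rw [hFdef]
    by_cases hx0 : f x = 0
    · rw [hx0]
      refine Finset.sum_eq_zero fun c hc => ?_
      have : (x : G) ∉ W c := fun h => (hmemS.1 hc).2 (((hWC x c hc).1 h).symm.trans hx0)
      rw [Set.indicator_of_notMem this]
    · have hxS : f x ∈ S := hmemS.2 ⟨⟨x, rfl⟩, hx0⟩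
      rw [Finset.sum_eq_single (f x)]
      · rw [Set.indicator_of_mem ((hWC x (f x) hxS).2 rfl)]
      · intro c hc hne
        have : (x : G) ∉ W c := fun h => hne ((hWC x c hc).1 h).symm
        rw [Set.indicator_of_notMem this]
      · intro h
        exact (h hxS).elim

/-- **The case of complex test functions**: a locally constant compactly supported `f : C → ℂ` on a subset
`C` of a locally compact Hausdorff totally disconnected space extends to a locally constant compactly
supported `F : G → ℂ` with `F ∘ (↑) = f`. [cite: BernsteinZelevinsky1976, Prop. 1.8] -/
theorem exists_isLocallyConstant_hasCompactSupport_comp_eq {C : Set G} {f : C → ℂ}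
    (hf : IsLocallyConstant f) (hfs : HasCompactSupport f) :
    ∃ F : G → ℂ, IsLocallyConstant F ∧ HasCompactSupport F ∧ F ∘ ((↑) : C → G) = f := by
  obtain ⟨F, hF, hFs, hFf⟩ := exists_isLocallyConstant_hasCompactSupport_extend hf hfs
  exact ⟨F, hF, hFs, funext hFf⟩

end Extend

end Literature.Topology
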